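import Summits.CriticalPhenomena.CardyFormulaZ2.Theorems.CardyBoundaryCoulombGasRectilinearCardyRowDefs
import HarnessLib

/-!
# Stub `stub_kernelWindowLaw` of line `excursion-kernel-covariance`, part 3: Riemann sums along `δℤ`
# (crux `RectilinearCardy`, stmt-CriticalPhenomena-5660, route `CardyBoundaryCoulombGas`)

First real-analysis input of the kernel window law (the passage from the uniform point asymptotics
of the cube-root weight on flat windows to the convergence of the renormalised window masses): the
feet of the boundary-row vertices of a flat window form a `δ`-progression on the side segment, so the
renormalised window mass is a Riemann sum of the continuum point kernel along the lattice `δℤ` of the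
tangential coordinate.

* `kwl_riemann_sum` — for `f` continuous on `[a, b]` and every finite set of integers `K` sandwiched
  between the open and the closed lattice interval, `|Σ_{k ∈ K} δ f(δk) - ∫_a^b f| ≤ ε` once `δ` is
  small (uniform continuity on the cells `[δk, δ(k+1)]`; the at most two end points and the two end
  pieces of the integral contribute `O(δ)`).

[folklore] calculus.
-/

noncomputable section

open Set Filter Topology MeasureTheory Metric

namespace Summit.CriticalPhenomena.CardyFormulaZ2.Cruxes.RectilinearCardy.ExcursionKernelCovariance

/-! ### Riemann sums along the lattice `δℤ` -/

/-- **Riemann sums of a continuous function along `δℤ`.** If `f` is continuous on `[a, b]`, then for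
every `ε > 0` there is `δ₀ > 0` such that for all `0 < δ < δ₀` and every finite `K ⊆ ℤ` with
`{k : a < δk < b} ⊆ K ⊆ {k : a ≤ δk ≤ b}`: `|Σ_{k ∈ K} δ f(δk) - ∫_a^b f| ≤ ε`. [folklore] -/
theorem kwl_riemann_sum {f : ℝ → ℝ} {a b : ℝ} (hab : a ≤ b) (hf : ContinuousOn f (Icc a b))
    {ε : ℝ} (hε : 0 < ε) :
    ∃ δ₀ : ℝ, 0 < δ₀ ∧ ∀ δ : ℝ, 0 < δ → δ < δ₀ → ∀ K : Finset ℤ,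
      (∀ k ∈ K, a ≤ δ * k ∧ δ * k ≤ b) → (∀ k : ℤ, a < δ * k → δ * k < b → k ∈ K) →
      |∑ k ∈ K, δ * f (δ * k) - ∫ x in a..b, f x| ≤ ε := by
  obtain ⟨M, hM⟩ := isCompact_Icc.exists_bound_of_continuousOn hf
  have hM0 : 0 ≤ M := (norm_nonneg _).trans (hM a (left_mem_Icc.2 hab))
  have hfM : ∀ x ∈ Icc a b, |f x| ≤ M := fun x hx => by simpa [Real.norm_eq_abs] using hM x hx
  have hba : 0 < b - a + 1 := by linarith
  obtain ⟨θ, hθ, hθuc⟩ := Metric.uniformContinuousOn_iff.1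
    (isCompact_Icc.uniformContinuousOn_of_continuous hf) (ε / (2 * (b - a + 1))) (by positivity)
  refine ⟨min θ (ε / (10 * (M + 1))), lt_min hθ (by positivity), fun δ hδ hδlt K hK hK' => ?_⟩
  have hδθ : δ < θ := lt_of_lt_of_le hδlt (min_le_left _ _)
  have hδM : 10 * (M + 1) * δ < ε := by
    have := lt_of_lt_of_le hδlt (min_le_right _ _)
    rwa [lt_div_iff₀ (by positivity), mul_comm] at this
  -- the extreme lattice indices strictly inside `(a, b)`
  set k₀ : ℤ := ⌊a / δ⌋ + 1 with hk₀
  set k₁ : ℤ := ⌈b / δ⌉ - 1 with hk₁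
  have ha₀ : a < δ * k₀ := by
    have : a / δ < (k₀ : ℝ) := by rw [hk₀]; push_cast; exact Int.lt_floor_add_one _
    rwa [div_lt_iff₀ hδ, mul_comm] at this
  have ha₀' : δ * ((k₀ : ℝ) - 1) ≤ a := by
    have : (k₀ : ℝ) - 1 ≤ a / δ := by rw [hk₀]; push_cast; linarith [Int.floor_le (a / δ)]
    rwa [le_div_iff₀ hδ, mul_comm] at this
  have hb₁ : δ * k₁ < b := by
    have : (k₁ : ℝ) < b / δ := by rw [hk₁]; push_cast; linarith [Int.ceil_lt_add_one (b / δ)]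
    rwa [lt_div_iff₀ hδ, mul_comm] at this
  have hb₁' : b ≤ δ * ((k₁ : ℝ) + 1) := by
    have : b / δ ≤ (k₁ : ℝ) + 1 := by rw [hk₁]; push_cast; linarith [Int.le_ceil (b / δ)]
    rwa [div_le_iff₀ hδ, mul_comm] at this
  have hKsub : ∀ k ∈ K, k₀ - 1 ≤ k ∧ k ≤ k₁ + 1 := by
    intro k hk
    obtain ⟨h1, h2⟩ := hK k hk
    constructor
    · have h1' : a / δ ≤ (k : ℝ) := by rwa [div_le_iff₀ hδ, mul_comm]
      have : ⌊a / δ⌋ ≤ k := Int.cast_le.1 ((Int.floor_le _).trans h1')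
      omega
    · have h2' : (k : ℝ) ≤ b / δ := by rwa [le_div_iff₀ hδ, mul_comm]
      have : k ≤ ⌈b / δ⌉ := Int.cast_le.1 (h2'.trans (Int.le_ceil _))
      omega
  have hIK : ∀ k : ℤ, k₀ ≤ k → k ≤ k₁ → k ∈ K := by
    intro k h0 h1
    apply hK'
    · calc a < δ * k₀ := ha₀
        _ ≤ δ * k := by gcongr
    · calc δ * k ≤ δ * k₁ := by gcongr
        _ < b := hb₁
  have hterm : ∀ k ∈ K, |δ * f (δ * k)| ≤ δ * M := fun k hk => by
    rw [abs_mul, abs_of_pos hδ]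
    exact mul_le_mul_of_nonneg_left (hfM _ (hK k hk)) hδ.le
  have hint : ∀ x y : ℝ, a ≤ x → x ≤ y → y ≤ b → IntervalIntegrable f volume x y :=
    fun x y hx hxy hy => (hf.mono (Icc_subset_Icc hx hy)).intervalIntegrable_of_Icc hxy
  have hIbound : ∀ x y : ℝ, a ≤ x → x ≤ b → a ≤ y → y ≤ b → |∫ t in x..y, f t| ≤ M * |y - x| := by
    intro x y hx hxb hy hyb
    have := intervalIntegral.norm_integral_le_of_norm_le_const (a := x) (b := y) (f := f) (C := M)
      (fun t ht => hM t ⟨(le_min hx hy).trans ht.1.le, ht.2.trans (max_le hxb hyb)⟩)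
    simpa [Real.norm_eq_abs] using this
  rcases lt_or_ge k₁ k₀ with hlt | hle
  · -- no lattice point strictly inside `(a, b)`: everything is `O(δ)`
    have hcard : K.card ≤ 2 := by
      have hsub : K ⊆ Finset.Icc (k₀ - 1) (k₁ + 1) := fun k hk =>
        Finset.mem_Icc.2 (hKsub k hk)
      refine (Finset.card_le_card hsub).trans ?_
      rw [Int.card_Icc]
      exact Int.toNat_le.2 (by push_cast; omega)
    have hsum : |∑ k ∈ K, δ * f (δ * k)| ≤ 2 * (δ * M) := by
      refine (Finset.abs_sum_le_sum_abs _ _).trans ?_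
      refine (Finset.sum_le_sum hterm).trans ?_
      rw [Finset.sum_const, nsmul_eq_mul]
      gcongr
      exact_mod_cast hcard
    have hab' : b - a ≤ δ := by
      have : (k₁ : ℝ) + 1 ≤ k₀ := by exact_mod_cast hlt
      nlinarith
    have hI : |∫ x in a..b, f x| ≤ M * δ := by
      refine (hIbound a b le_rfl hab hab le_rfl).trans ?_
      rw [abs_of_nonneg (sub_nonneg.2 hab)]
      exact mul_le_mul_of_nonneg_left hab' hM0
    calc |∑ k ∈ K, δ * f (δ * k) - ∫ x in a..b, f x|
        ≤ |∑ k ∈ K, δ * f (δ * k)| + |∫ x in a..b, f x| := abs_sub _ _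
      _ ≤ 2 * (δ * M) + M * δ := add_le_add hsum hI
      _ ≤ ε := by nlinarith
  · -- the inner lattice points `k₀, …, k₁`
    obtain ⟨n, hn⟩ : ∃ n : ℕ, k₁ - k₀ = n := Int.eq_ofNat_of_zero_le (by omega)
    set p : ℕ → ℝ := fun i => δ * ((k₀ : ℝ) + i) with hp
    have hp0 : a < p 0 := by simp only [hp, Nat.cast_zero, add_zero]; exact ha₀
    have hpn : p n < b := by
      have : ((k₀ : ℝ) + n) = k₁ := by
        have : (k₁ : ℝ) - k₀ = n := by exact_mod_cast hn
        linarith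
      simp only [hp, this]; exact hb₁
    have hpmono : ∀ i j : ℕ, i ≤ j → p i ≤ p j := fun i j hij => by
      simp only [hp]; gcongr
    have hpsucc : ∀ i : ℕ, p (i + 1) = p i + δ := fun i => by
      simp only [hp]; push_cast; ring
    have hpa : ∀ i ≤ n, a ≤ p i := fun i hi => hp0.le.trans (hpmono 0 i (Nat.zero_le _))
    have hpb : ∀ i ≤ n, p i ≤ b := fun i hi => (hpmono i n hi).trans hpn.le
    set I : Finset ℤ := (Finset.range (n + 1)).image fun i : ℕ => k₀ + (i : ℤ) with hI
    have hinj : Set.InjOn (fun i : ℕ => k₀ + (i : ℤ)) ↑(Finset.range (n + 1)) := by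
      intro i _ j _ h
      have : (i : ℤ) = j := by simpa using h
      exact_mod_cast this
    have hIK' : I ⊆ K := by
      intro k hk
      rw [hI, Finset.mem_image] at hk
      obtain ⟨i, hi, rfl⟩ := hk
      rw [Finset.mem_range] at hi
      exact hIK _ (by omega) (by omega)
    have hKI : ∀ k ∈ K \ I, k = k₀ - 1 ∨ k = k₁ + 1 := by
      intro k hk
      rw [Finset.mem_sdiff] at hk
      obtain ⟨h1, h2⟩ := hKsub k hk.1
      by_contra hcon
      push Not at hcon
      refine hk.2 ?_
      rw [hI, Finset.mem_image]
      obtain ⟨i, hi⟩ : ∃ i : ℕ, k - k₀ = i := Int.eq_ofNat_of_zero_le (by omega)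
      exact ⟨i, Finset.mem_range.2 (by omega), by omega⟩
    have hcard : (K \ I).card ≤ 2 := by
      have hsub : K \ I ⊆ {k₀ - 1, k₁ + 1} := fun k hk => by
        rcases hKI k hk with h | h <;> simp [h]
      exact (Finset.card_le_card hsub).trans (Finset.card_le_two)
    -- the outer sum is `O(δ)`
    have hout : |∑ k ∈ K \ I, δ * f (δ * k)| ≤ 2 * (δ * M) := by
      refine (Finset.abs_sum_le_sum_abs _ _).trans ?_
      refine (Finset.sum_le_sum fun k hk => hterm k (Finset.sdiff_subset hk)).trans ?_
      rw [Finset.sum_const, nsmul_eq_mul]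
      gcongr
      exact_mod_cast hcard
    -- the inner sum, reindexed
    have hinner : ∑ k ∈ I, δ * f (δ * k) = ∑ i ∈ Finset.range n, δ * f (p i) + δ * f (p n) := by
      rw [hI, Finset.sum_image hinj, Finset.sum_range_succ]
      simp only [hp]
      push_cast
      rfl
    -- the integral, split along the cells
    have hsplit : ∫ x in a..b, f x = (∫ x in a..p 0, f x) +
        ∑ i ∈ Finset.range n, (∫ x in p i..p (i + 1), f x) + ∫ x in p n..b, f x := by
      rw [intervalIntegral.sum_integral_adjacent_intervals fun i hi =>
        hint _ _ (hpa i hi.le) (hpmono i (i + 1) (Nat.le_succ i)) (hpb (i + 1) hi)]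
      rw [intervalIntegral.integral_add_adjacent_intervals (hint _ _ le_rfl hp0.le (hpb 0 n.zero_le))
        (hint _ _ (hpa 0 n.zero_le) (hpmono 0 n n.zero_le) (hpb n le_rfl)),
        intervalIntegral.integral_add_adjacent_intervals (hint _ _ le_rfl (hpa n le_rfl) (hpb n le_rfl))
        (hint _ _ (hpa n le_rfl) hpn.le le_rfl)]
    -- cell estimates
    have hcell : ∀ i < n, |(∫ x in p i..p (i + 1), f x) - δ * f (p i)| ≤ δ * (ε / (2 * (b - a + 1))) := by
      intro i hi
      have hpi_a := hpa i hi.le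
      have hpi1_b := hpb (i + 1) hi
      have heq : (∫ x in p i..p (i + 1), f x) - δ * f (p i) = ∫ x in p i..p (i + 1), (f x - f (p i)) := by
        rw [intervalIntegral.integral_sub (hint _ _ hpi_a (hpmono i (i+1) (Nat.le_succ i)) hpi1_b)
          intervalIntegrable_const, intervalIntegral.integral_const, hpsucc, smul_eq_mul]
        ring
      rw [heq, hpsucc]
      have := intervalIntegral.norm_integral_le_of_norm_le_const (a := p i) (b := p i + δ)
        (f := fun x => f x - f (p i)) (C := ε / (2 * (b - a + 1))) (fun x hx => ?_)
      · rw [add_sub_cancel_left, abs_of_pos hδ] at this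
        simpa [Real.norm_eq_abs, mul_comm] using this
      · rw [uIoc_of_le (by linarith)] at hx
        have hxI : x ∈ Icc a b := ⟨hpi_a.trans hx.1.le, hx.2.trans (by rw [← hpsucc]; exact hpi1_b)⟩
        have hd : dist x (p i) < θ := by
          rw [Real.dist_eq, abs_of_pos (sub_pos.2 hx.1)]; linarith [hx.2]
        have := hθuc x hxI (p i) ⟨hpi_a, (hpmono i (i+1) (Nat.le_succ i)).trans hpi1_b⟩ hd
        rw [Real.dist_eq] at this
        simpa [Real.norm_eq_abs] using this.le
    have hcells : |∑ i ∈ Finset.range n, ((∫ x in p i..p (i + 1), f x) - δ * f (p i))| ≤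
        (b - a) * (ε / (2 * (b - a + 1))) := by
      refine (Finset.abs_sum_le_sum_abs _ _).trans ?_
      refine (Finset.sum_le_sum fun i hi => hcell i (Finset.mem_range.1 hi)).trans ?_
      rw [Finset.sum_const, Finset.card_range, nsmul_eq_mul]
      have hnδ : (n : ℝ) * δ ≤ b - a := by
        have : p n - p 0 = n * δ := by simp only [hp]; push_cast; ring
        linarith
      calc (n : ℝ) * (δ * (ε / (2 * (b - a + 1)))) = (n * δ) * (ε / (2 * (b - a + 1))) := by ring
        _ ≤ (b - a) * (ε / (2 * (b - a + 1))) := by gcongr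
    -- end pieces
    have hE0 : |∫ x in a..p 0, f x| ≤ M * δ := by
      refine (hIbound a (p 0) le_rfl hab hp0.le (hpb 0 n.zero_le)).trans ?_
      refine mul_le_mul_of_nonneg_left ?_ hM0
      rw [abs_of_pos (sub_pos.2 hp0)]
      have : p 0 = δ * k₀ := by simp [hp]
      linarith
    have hEn : |∫ x in p n..b, f x| ≤ M * δ := by
      refine (hIbound (p n) b (hpa n le_rfl) hpn.le hab le_rfl).trans ?_
      refine mul_le_mul_of_nonneg_left ?_ hM0
      rw [abs_of_pos (sub_pos.2 hpn)]
      have : p n = δ * k₁ := by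
        have : ((k₀ : ℝ) + n) = k₁ := by
          have : (k₁ : ℝ) - k₀ = n := by exact_mod_cast hn
          linarith
        simp only [hp, this]
      linarith
    have hlast : |δ * f (p n)| ≤ δ * M := by
      rw [abs_mul, abs_of_pos hδ]
      exact mul_le_mul_of_nonneg_left (hfM _ ⟨hpa n le_rfl, hpn.le⟩) hδ.le
    -- assemble
    have hKsum : ∑ k ∈ K, δ * f (δ * k) = ∑ k ∈ K \ I, δ * f (δ * k) + ∑ k ∈ I, δ * f (δ * k) :=
      (Finset.sum_sdiff hIK').symm
    have hdecomp : ∑ k ∈ K, δ * f (δ * k) - ∫ x in a..b, f x =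
        ∑ k ∈ K \ I, δ * f (δ * k) + δ * f (p n) - (∫ x in a..p 0, f x) - (∫ x in p n..b, f x) -
          ∑ i ∈ Finset.range n, ((∫ x in p i..p (i + 1), f x) - δ * f (p i)) := by
      rw [hKsum, hinner, hsplit, Finset.sum_sub_distrib]
      ring
    rw [hdecomp]
    have hε2 : (b - a) * (ε / (2 * (b - a + 1))) ≤ ε / 2 := by
      have h1 : (b - a) / (b - a + 1) ≤ 1 := by rw [div_le_one hba]; linarith
      calc (b - a) * (ε / (2 * (b - a + 1))) = (ε / 2) * ((b - a) / (b - a + 1)) := by field_simp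
        _ ≤ (ε / 2) * 1 := by gcongr
        _ = ε / 2 := mul_one _
    calc |∑ k ∈ K \ I, δ * f (δ * k) + δ * f (p n) - (∫ x in a..p 0, f x) - (∫ x in p n..b, f x) -
          ∑ i ∈ Finset.range n, ((∫ x in p i..p (i + 1), f x) - δ * f (p i))|
        ≤ |∑ k ∈ K \ I, δ * f (δ * k)| + |δ * f (p n)| + |∫ x in a..p 0, f x| + |∫ x in p n..b, f x| +
          |∑ i ∈ Finset.range n, ((∫ x in p i..p (i + 1), f x) - δ * f (p i))| := by
          have h1 := abs_add_le (∑ k ∈ K \ I, δ * f (δ * k)) (δ * f (p n))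
          have h2 := abs_sub (∑ k ∈ K \ I, δ * f (δ * k) + δ * f (p n)) (∫ x in a..p 0, f x)
          have h3 := abs_sub (∑ k ∈ K \ I, δ * f (δ * k) + δ * f (p n) - ∫ x in a..p 0, f x)
            (∫ x in p n..b, f x)
          have h4 := abs_sub (∑ k ∈ K \ I, δ * f (δ * k) + δ * f (p n) - (∫ x in a..p 0, f x) -
            ∫ x in p n..b, f x) (∑ i ∈ Finset.range n, ((∫ x in p i..p (i + 1), f x) - δ * f (p i)))
          linarith
      _ ≤ 2 * (δ * M) + δ * M + M * δ + M * δ + (b - a) * (ε / (2 * (b - a + 1))) := by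
          gcongr
      _ ≤ ε := by nlinarith

end Summit.CriticalPhenomena.CardyFormulaZ2.Cruxes.RectilinearCardy.ExcursionKernelCovariance

end
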